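import Summits.BirchSwinnertonDyer.BirchSwinnertonDyer.Theorems.ResidualThetaTransportAtTwoResidualSignedLambdaLowerCMAtTwoAwayKernel
import Summits.BirchSwinnertonDyer.BirchSwinnertonDyer.Theorems.ResidualThetaTransportAtTwoResidualSignedLambdaLowerCMAtTwoCofreeTorsionIncl
import Summits.BirchSwinnertonDyer.BirchSwinnertonDyer.Theorems.ResidualThetaTransportAtTwoResidualSignedLambdaLowerCMAtTwoAwayResMap
import HarnessLib

/-!
# GLUE package T2 (b), second half: the level inclusions `A_ρ[p^k] ↪ A_ρ[p^K]` (`k ≤ K`), the TRANSITIONS `tAway` of the directed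
# `(n, k)`-system `H¹(U_{n,w}, A_ρ[2^k]|)`, `j ∘ t = j`, and the KERNEL CRITERION for `jAway` (injectivity half of
# `D_w = H¹(ℚ_{∞,w̃}, A_ρ) = lim→_{n,k} H¹(U_{n,w}, A_ρ[2^k]|)`)

Route `ResidualThetaTransportAtTwo` (RTT), crux RSL_g `ResidualSignedLambdaLowerCMAtTwo` (stmt-BirchSwinnertonDyer-22608), line «onepair»; LEAD
`prover-bsd-wall-rtt-p2` g19 (`--supports 22608 --as helper`, closes nothing). Sequel of `…AwayKernel` (p705480: group-direction kernel
criterion `AwayKernel.exists_resLe_layerGroup_eq_zero` and the character glue `AwayKernel.exists_addMonoidHom_of_directed`) and of tp2-p2x's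
`…CofreeTorsionIncl` (p705712: the ONE-STEP inclusion `cofreeTorsionIncl S ρ k : A_ρ[p^k] ⟶ A_ρ[p^{k+1}]`), over the generic calculus
`…AwayResMap` (p707990: the calculus of `H¹(f|_H) ∘ res_{H ≤ H'}` for an abstract `TopRep`). Small DEFINITIONS with bodies (`cofreeTorsionInclLE` /
`cofreeTorsionLocalInclLE` — the inclusion for an arbitrary `k ≤ K`, written `a ↦ 1 • a` exactly as p705712; `OnePair.tAway` — the transition of
the `(n, k)`-system, of the shape `H¹(f|) ∘ res`) + theorems; no named fact, no instance, no notation, no `sorry`. BSD is not proved by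
any of this; RSL_g (22608) stays OPEN.

WHY (GLUE-SPEC-g18 §1 T2 (b)). The S₀-side pin bundle `AwayPins` (`…AwayDefs`) asks for `locdS x w c : CharacterModule (Dloc w)` with
prescribed values on the images of ALL `jAway w m k` (`AwayPins.hlocdS`), so the character glue runs over the directed set `ℕ × ℕ` and needs
transitions `t : Dlev w n k →+ Dlev w m K` for every `(n, k) ≤ (m, K)` with (i) `j ∘ t = j` (`jAway_tAway`), (ii) functoriality
(`tAway_refl`, `tAway_tAway`), (iii) the kernel criterion `jAway y = 0 → ∃ (m, K) ≥ (n, k), t y = 0` (`exists_tAway_eq_zero_of_jAway_eq_zero`: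
coefficient direction — the coboundary witness `v ∈ A_ρ` is `2`-primary, `ProfiniteExhaustion.exists_pow_smul_cofree_eq_zero`, so lies in some
`A_ρ[2^K]` — then the group direction of p705480), and (iv) the identification of the one-step transition in `k` with the push-forward along
tp2-p2x's `cofreeTorsionLocalIncl` (`tAway_succ_right`), so that the `k`-direction value compatibility proved in that currency
(`…DeepHalfAwayTwoTowerPow`) is consumed verbatim.

KERNEL DISCIPLINE. Every cocycle-level identity is proved ONCE for an abstract `TopRep` over an abstract topological group (`…AwayResMap`, p707990, where
subgroups are variables and definitional unfolding is cheap), and §2–§3 here only INSTANTIATE and rewrite with the pointwise value lemmas of §1;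
no `rfl` is asked of the kernel at the concrete modules `A_ρ[2^k]|_{U_{n,w}}`.

* §1 `cofreeTorsionInclLE S ρ h : A_ρ[p^k] ⟶ A_ρ[p^K]` (`h : k ≤ K`), `cofreeTorsionLocalInclLE … v`, values, factorisations, injectivity of
  `cofreeTorsionLocalInclusion`, agreement with `cofreeTorsionLocalIncl` at `K = k + 1`.
* §2 `OnePair.tAway S κ ρ w hnm hkK : Dlev w n k →+ Dlev w m K`, `tAway_apply`, `tAway_oneCocycleClass_eq`, `jAway_tAway`, `tAway_refl`,
  `tAway_left`, `tAway_succ_right`, `tAway_tAway`, `resLe_tAway`.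
* §3 `OnePair.exists_tAway_eq_zero_of_jAway_eq_zero`.

References: [SerreGaloisCohomology1997] I §2.2 Prop. 8, §2.4; [Kato2004Asterisque] §13.8 (p. 228); [GreenbergVatsal2000] §2 Prop. 2.4.
-/

set_option autoImplicit false
-- the Theorems namespace of this sub repeats the summit name by design (D-0017 nested layout)
set_option linter.dupNamespace false

noncomputable section

open scoped Classical
open CategoryTheory Topology Field NumberField IsDedekindDomain
open Literature.NumberTheory.GaloisRepresentations Literature.NumberTheory.EllipticCurves
open Literature.NumberTheory.EllipticCurves.GreenbergSelmer Literature.NumberTheory.EllipticCurves.CyclotomicLayer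

universe v

/-! ## §1 The level inclusions `A_ρ[p^k] ↪ A_ρ[p^K]` (`k ≤ K`) as morphisms of discrete modules -/

namespace Summit.BirchSwinnertonDyer.BirchSwinnertonDyer.Theorems.ThetaTransport

section InclLE

variable {p : ℕ} [Fact p.Prime] (S : Set (PadicAlgCl p)) {d : ℕ} (ρ : FramedGaloisRep ℚ ↥(padicCoeffIntegers S) d) {k K : ℕ}

/-- `1 • a ∈ A_ρ[p^K]` for `a ∈ A_ρ[p^k]`, `k ≤ K` (the inclusion is written `a ↦ 1 • a`, the kernel-friendly form of p705712).
[cite: Kato2004Asterisque, §13.8 (p. 228)] -/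
theorem one_zsmul_mem_cofreeTorsionBy_pow_of_le (h : k ≤ K) (a : ↥(AddSubgroup.torsionBy (Cofree ρ ↥(padicCoeffField S)) ((p ^ k : ℕ) : ℤ))) :
    (1 : ℤ) • (a : Cofree ρ ↥(padicCoeffField S)) ∈ AddSubgroup.torsionBy (Cofree ρ ↥(padicCoeffField S)) ((p ^ K : ℕ) : ℤ) := by
  refine (Submodule.mem_torsionBy_iff (R := ℤ) _ _).mpr ?_
  rw [one_zsmul]
  obtain ⟨e, rfl⟩ := Nat.exists_eq_add_of_le h
  have hK : ((p ^ (k + e) : ℕ) : ℤ) = ((p ^ e : ℕ) : ℤ) * ((p ^ k : ℕ) : ℤ) := by push_cast; ring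
  rw [hK, mul_smul, (Submodule.mem_torsionBy_iff (R := ℤ) _ _).mp a.2, smul_zero]

/-- **`ι : A_ρ[p^k] ⟶ A_ρ[p^K]`** (`k ≤ K`), the inclusion (written `a ↦ 1 • a`), as a morphism of the discrete `Γ_ℚ`-modules — tp2-p2x's
one-step `cofreeTorsionIncl` (p705712) for every `k ≤ K`, same construction. [cite: Kato2004Asterisque, §13.8 (p. 228)] -/
def cofreeTorsionInclLE (h : k ≤ K) :
    (cofreeTorsionGaloisModule S ρ ((p ^ k : ℕ) : ℤ)).toTopRep ⟶ (cofreeTorsionGaloisModule S ρ ((p ^ K : ℕ) : ℤ)).toTopRep :=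
  TopRep.ofHom
    { toContinuousLinearMap :=
        { toFun := fun a ↦ ⟨(1 : ℤ) • (a : Cofree ρ ↥(padicCoeffField S)), one_zsmul_mem_cofreeTorsionBy_pow_of_le S ρ h a⟩
          map_add' := fun a b ↦ Subtype.ext (by
            change (1 : ℤ) • ((a : Cofree ρ ↥(padicCoeffField S)) + (b : Cofree ρ ↥(padicCoeffField S))) =
              (1 : ℤ) • (a : Cofree ρ ↥(padicCoeffField S)) + (1 : ℤ) • (b : Cofree ρ ↥(padicCoeffField S))
            rw [zsmul_add])
          map_smul' := fun c a ↦ Subtype.ext (by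
            change (1 : ℤ) • (c • (a : Cofree ρ ↥(padicCoeffField S))) = c • ((1 : ℤ) • (a : Cofree ρ ↥(padicCoeffField S)))
            rw [smul_comm])
          cont := continuous_of_discreteTopology }
      isIntertwining' := fun σ ↦ by
        ext a
        change (1 : ℤ) • ((cofreeTorsionGaloisModule S ρ _ σ a : ↥(AddSubgroup.torsionBy _ _)) : Cofree ρ ↥(padicCoeffField S)) =
          σ • ((1 : ℤ) • (a : Cofree ρ ↥(padicCoeffField S)))
        rw [cofreeTorsionGaloisModule_apply_apply, Literature.NumberTheory.EllipticCurves.AddSubgroup.torsionBy.coe_smul]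
        exact (map_zsmul (DistribSMul.toAddMonoidHom (Cofree ρ ↥(padicCoeffField S)) σ) (1 : ℤ) (a : Cofree ρ ↥(padicCoeffField S))).symm }

/-- Raw values of `cofreeTorsionInclLE`: `a ↦ 1 • a` (definitional). [cite: Kato2004Asterisque, §13.8 (p. 228)] -/
theorem coe_cofreeTorsionInclLE_apply' (h : k ≤ K) (a : ↥(AddSubgroup.torsionBy (Cofree ρ ↥(padicCoeffField S)) ((p ^ k : ℕ) : ℤ))) :
    (((cofreeTorsionInclLE S ρ h).hom a : ↥(AddSubgroup.torsionBy (Cofree ρ ↥(padicCoeffField S)) ((p ^ K : ℕ) : ℤ))) :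
      Cofree ρ ↥(padicCoeffField S)) = (1 : ℤ) • (a : Cofree ρ ↥(padicCoeffField S)) := rfl

/-- Values of `cofreeTorsionInclLE`: `a ↦ a`. [cite: Kato2004Asterisque, §13.8 (p. 228)] -/
@[simp] theorem coe_cofreeTorsionInclLE_apply (h : k ≤ K) (a : ↥(AddSubgroup.torsionBy (Cofree ρ ↥(padicCoeffField S)) ((p ^ k : ℕ) : ℤ))) :
    (((cofreeTorsionInclLE S ρ h).hom a : ↥(AddSubgroup.torsionBy (Cofree ρ ↥(padicCoeffField S)) ((p ^ K : ℕ) : ℤ))) :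
      Cofree ρ ↥(padicCoeffField S)) = (a : Cofree ρ ↥(padicCoeffField S)) := by
  rw [coe_cofreeTorsionInclLE_apply', one_zsmul]

/-- `(A_ρ[p^K] ↪ A_ρ) ∘ ι = (A_ρ[p^k] ↪ A_ρ)`. [cite: Kato2004Asterisque, §13.8 (p. 228)] -/
theorem cofreeTorsionInclusion_cofreeTorsionInclLE (h : k ≤ K) (a : ↥(AddSubgroup.torsionBy (Cofree ρ ↥(padicCoeffField S)) ((p ^ k : ℕ) : ℤ))) :
    (cofreeTorsionInclusion S ρ ((p ^ K : ℕ) : ℤ)).hom ((cofreeTorsionInclLE S ρ h).hom a) =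
      (cofreeTorsionInclusion S ρ ((p ^ k : ℕ) : ℤ)).hom a := by
  rw [cofreeTorsionInclusion_apply, cofreeTorsionInclusion_apply, coe_cofreeTorsionInclLE_apply]

/-- At `K = k + 1` the inclusion is tp2-p2x's one-step `cofreeTorsionIncl` (pointwise). [cite: Kato2004Asterisque, §13.8 (p. 228)] -/
theorem cofreeTorsionInclLE_succ_apply (a : ↥(AddSubgroup.torsionBy (Cofree ρ ↥(padicCoeffField S)) ((p ^ k : ℕ) : ℤ))) :
    (cofreeTorsionInclLE S ρ (Nat.le_succ k)).hom a = (cofreeTorsionIncl S ρ k).hom a :=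
  Subtype.ext (by rw [coe_cofreeTorsionInclLE_apply, coe_cofreeTorsionIncl_apply])

/-- `ι` along `k ≤ k` is the identity (pointwise). [cite: Kato2004Asterisque, §13.8 (p. 228)] -/
theorem cofreeTorsionInclLE_refl_apply (a : ↥(AddSubgroup.torsionBy (Cofree ρ ↥(padicCoeffField S)) ((p ^ k : ℕ) : ℤ))) :
    (cofreeTorsionInclLE S ρ (le_refl k)).hom a = a :=
  Subtype.ext (coe_cofreeTorsionInclLE_apply S ρ (le_refl k) a)

/-- Transitivity `ι_{K ≤ K'} ∘ ι_{k ≤ K} = ι_{k ≤ K'}` (pointwise). [cite: Kato2004Asterisque, §13.8 (p. 228)] -/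
theorem cofreeTorsionInclLE_cofreeTorsionInclLE_apply {K' : ℕ} (h : k ≤ K) (h' : K ≤ K')
    (a : ↥(AddSubgroup.torsionBy (Cofree ρ ↥(padicCoeffField S)) ((p ^ k : ℕ) : ℤ))) :
    (cofreeTorsionInclLE S ρ h').hom ((cofreeTorsionInclLE S ρ h).hom a) = (cofreeTorsionInclLE S ρ (h.trans h')).hom a :=
  Subtype.ext (by rw [coe_cofreeTorsionInclLE_apply, coe_cofreeTorsionInclLE_apply, coe_cofreeTorsionInclLE_apply])

variable (v : HeightOneSpectrum (𝓞 ℚ))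

/-- **`ι|_{Γ_v} : A_ρ[p^k]|_{Γ_v} ⟶ A_ρ[p^K]|_{Γ_v}`** (`k ≤ K`) on the local coefficient modules. [cite: Kato2004Asterisque, §13.8 (p. 228)] -/
def cofreeTorsionLocalInclLE (h : k ≤ K) :
    localRepOf (cofreeTorsionGaloisModule S ρ ((p ^ k : ℕ) : ℤ)) v ⟶ localRepOf (cofreeTorsionGaloisModule S ρ ((p ^ K : ℕ) : ℤ)) v :=
  TopRep.ofHom ((cofreeTorsionInclLE S ρ h).hom.restrictField (v.adicCompletion ℚ))

/-- The local form has the same underlying map. [cite: Kato2004Asterisque, §13.8 (p. 228)] -/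
theorem cofreeTorsionLocalInclLE_apply (h : k ≤ K) (a : ↥(AddSubgroup.torsionBy (Cofree ρ ↥(padicCoeffField S)) ((p ^ k : ℕ) : ℤ))) :
    (cofreeTorsionLocalInclLE S ρ v h).hom a = (cofreeTorsionInclLE S ρ h).hom a := rfl

/-- Values of `cofreeTorsionLocalInclLE`: `a ↦ a`. [cite: Kato2004Asterisque, §13.8 (p. 228)] -/
@[simp] theorem coe_cofreeTorsionLocalInclLE_apply (h : k ≤ K)
    (a : ↥(AddSubgroup.torsionBy (Cofree ρ ↥(padicCoeffField S)) ((p ^ k : ℕ) : ℤ))) :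
    (((cofreeTorsionLocalInclLE S ρ v h).hom a : ↥(AddSubgroup.torsionBy (Cofree ρ ↥(padicCoeffField S)) ((p ^ K : ℕ) : ℤ))) :
      Cofree ρ ↥(padicCoeffField S)) = (a : Cofree ρ ↥(padicCoeffField S)) := by
  rw [cofreeTorsionLocalInclLE_apply, coe_cofreeTorsionInclLE_apply]

/-- `(A_ρ[p^K]| ↪ A_ρ|) ∘ ι| = (A_ρ[p^k]| ↪ A_ρ|)` on the local coefficient modules. [cite: Kato2004Asterisque, §13.8 (p. 228)] -/
theorem cofreeTorsionLocalInclusion_cofreeTorsionLocalInclLE (h : k ≤ K)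
    (a : ↥(AddSubgroup.torsionBy (Cofree ρ ↥(padicCoeffField S)) ((p ^ k : ℕ) : ℤ))) :
    (cofreeTorsionLocalInclusion S ρ ((p ^ K : ℕ) : ℤ) v).hom ((cofreeTorsionLocalInclLE S ρ v h).hom a) =
      (cofreeTorsionLocalInclusion S ρ ((p ^ k : ℕ) : ℤ) v).hom a := by
  rw [cofreeTorsionLocalInclusion_apply, cofreeTorsionLocalInclusion_apply, coe_cofreeTorsionLocalInclLE_apply]

/-- `ι|` along `k ≤ k` is the identity (pointwise). [cite: Kato2004Asterisque, §13.8 (p. 228)] -/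
theorem cofreeTorsionLocalInclLE_refl_apply (a : ↥(AddSubgroup.torsionBy (Cofree ρ ↥(padicCoeffField S)) ((p ^ k : ℕ) : ℤ))) :
    (cofreeTorsionLocalInclLE S ρ v (le_refl k)).hom a = a := by
  rw [cofreeTorsionLocalInclLE_apply, cofreeTorsionInclLE_refl_apply]

/-- Transitivity of the local inclusions (pointwise). [cite: Kato2004Asterisque, §13.8 (p. 228)] -/
theorem cofreeTorsionLocalInclLE_cofreeTorsionLocalInclLE_apply {K' : ℕ} (h : k ≤ K) (h' : K ≤ K')
    (a : ↥(AddSubgroup.torsionBy (Cofree ρ ↥(padicCoeffField S)) ((p ^ k : ℕ) : ℤ))) :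
    (cofreeTorsionLocalInclLE S ρ v h').hom ((cofreeTorsionLocalInclLE S ρ v h).hom a) =
      (cofreeTorsionLocalInclLE S ρ v (h.trans h')).hom a := by
  rw [cofreeTorsionLocalInclLE_apply, cofreeTorsionLocalInclLE_apply, cofreeTorsionLocalInclLE_apply,
    cofreeTorsionInclLE_cofreeTorsionInclLE_apply]

/-- At `K = k + 1` the local inclusion is tp2-p2x's `cofreeTorsionLocalIncl` (pointwise). [cite: Kato2004Asterisque, §13.8 (p. 228)] -/
theorem cofreeTorsionLocalInclLE_succ_apply (a : ↥(AddSubgroup.torsionBy (Cofree ρ ↥(padicCoeffField S)) ((p ^ k : ℕ) : ℤ))) :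
    (cofreeTorsionLocalInclLE S ρ v (Nat.le_succ k)).hom a = (cofreeTorsionLocalIncl S ρ k v).hom a := by
  rw [cofreeTorsionLocalInclLE_apply, cofreeTorsionLocalIncl_apply, cofreeTorsionInclLE_succ_apply]

/-- `A_ρ[N]| ↪ A_ρ|` is injective. [cite: Kato2004Asterisque, §13.8 (p. 228)] -/
theorem cofreeTorsionLocalInclusion_injective (N : ℤ) : Function.Injective (cofreeTorsionLocalInclusion S ρ N v).hom := by
  intro a b hab
  rw [cofreeTorsionLocalInclusion_apply, cofreeTorsionLocalInclusion_apply] at hab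
  exact Subtype.ext hab

end InclLE

end Summit.BirchSwinnertonDyer.BirchSwinnertonDyer.Theorems.ThetaTransport

/-! ## §2 The transitions `tAway` of the `(n, k)`-system `Dlev w n k = H¹(U_{n,w}, A_ρ[2^k]|)` and `j ∘ t = j` -/

namespace Summit.BirchSwinnertonDyer.BirchSwinnertonDyer.Theorems.OnePair

open Summit.BirchSwinnertonDyer.BirchSwinnertonDyer.Theorems.ThetaTransport

variable (S : Set (PadicAlgCl 2)) (κ : ZpExtension ℚ 2) (ρ : FramedGaloisRep ℚ ↥(padicCoeffIntegers S) 2) (w : HeightOneSpectrum (𝓞 ℚ))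

/-- **The transition `t : Dlev w n k →+ Dlev w m K`** of the directed system (`n ≤ m`, `k ≤ K`): restrict from `U_{n,w}` to `U_{m,w}`, then
push the coefficients along `A_ρ[2^k] ↪ A_ρ[2^K]` (the shape `H¹(f|) ∘ res` of `…AwayResMap`). [cite: SerreGaloisCohomology1997, I §2.2]
[cite: Kato2004Asterisque, §13.8 (p. 228)] -/
def tAway {n m k K : ℕ} (hnm : n ≤ m) (hkK : k ≤ K) : Dlev S κ ρ w n k →+ Dlev S κ ρ w m K :=
  (cohomologyMap (subgroupRepMap (Y := localRepOf (cofreeTorsionGaloisModule S ρ ((2 ^ K : ℕ) : ℤ)) w)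
      (cofreeTorsionLocalInclLE S ρ w hkK) (layerGroup κ w m)) 1).hom.toLinearMap.toAddMonoidHom.comp
    (resLe (localRepOf (cofreeTorsionGaloisModule S ρ ((2 ^ k : ℕ) : ℤ)) w) (ProfiniteExhaustion.antitone_layerGroup κ w hnm) 1).hom.toLinearMap.toAddMonoidHom

/-- Unfolding `tAway` down to `cohomologyMap ∘ resLe` (`rfl`). [cite: SerreGaloisCohomology1997, I §2.2] -/
theorem tAway_apply {n m k K : ℕ} (hnm : n ≤ m) (hkK : k ≤ K) (y : Dlev S κ ρ w n k) :
    tAway S κ ρ w hnm hkK y =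
      cohomologyMap (subgroupRepMap (Y := localRepOf (cofreeTorsionGaloisModule S ρ ((2 ^ K : ℕ) : ℤ)) w)
          (cofreeTorsionLocalInclLE S ρ w hkK) (layerGroup κ w m)) 1
        (resLe (localRepOf (cofreeTorsionGaloisModule S ρ ((2 ^ k : ℕ) : ℤ)) w) (ProfiniteExhaustion.antitone_layerGroup κ w hnm) 1 y) :=
  rfl

/-- **`tAway` on cocycles (extensionality form)**: if a cocycle `ψ'` of `U_{m,w}` with values in `A_ρ[2^K]` has the same values IN `A_ρ` as `ψ`
(restricted to `U_m`), then `t [ψ] = [ψ']`. [cite: SerreGaloisCohomology1997, I §2.4] -/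
theorem tAway_oneCocycleClass_eq {n m k K : ℕ} (hnm : n ≤ m) (hkK : k ≤ K)
    (ψ : contOneCocycles (subgroupRep (localRepOf (cofreeTorsionGaloisModule S ρ ((2 ^ k : ℕ) : ℤ)) w) (layerGroup κ w n)))
    (ψ' : contOneCocycles (subgroupRep (localRepOf (cofreeTorsionGaloisModule S ρ ((2 ^ K : ℕ) : ℤ)) w) (layerGroup κ w m)))
    (hψ' : ∀ u : ↥(layerGroup κ w m),
      ((ψ'.1 u : ↥(AddSubgroup.torsionBy (Cofree ρ ↥(padicCoeffField S)) ((2 ^ K : ℕ) : ℤ))) : Cofree ρ ↥(padicCoeffField S)) =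
        ((ψ.1 (subgroupInclusion (ProfiniteExhaustion.antitone_layerGroup κ w hnm) u) :
          ↥(AddSubgroup.torsionBy (Cofree ρ ↥(padicCoeffField S)) ((2 ^ k : ℕ) : ℤ))) : Cofree ρ ↥(padicCoeffField S))) :
    tAway S κ ρ w hnm hkK (oneCocycleClass _ ψ) = oneCocycleClass _ ψ' := by
  rw [tAway_apply]
  refine AwayKernel.cohomologyMap_resLe_oneCocycleClass_eq_of_forall_apply _ _ _ _ fun u ↦ Subtype.ext ?_
  rw [coe_cofreeTorsionLocalInclLE_apply]
  exact (hψ' u).symm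

/-- **`j ∘ t = j`**: `jAway w m K (tAway y) = jAway w n k y`. [cite: SerreGaloisCohomology1997, I §2.4] [cite: GreenbergVatsal2000, §2 Prop. 2.4] -/
theorem jAway_tAway {n m k K : ℕ} (hnm : n ≤ m) (hkK : k ≤ K) (y : Dlev S κ ρ w n k) :
    jAway S κ ρ w m K (tAway S κ ρ w hnm hkK y) = jAway S κ ρ w n k y := by
  rw [jAway_apply, jAway_apply, tAway_apply,
    AwayKernel.cohomologyMap_resLe_cohomologyMap_resLe_of_forall_apply _ _ (cofreeTorsionLocalInclusion S ρ ((2 ^ k : ℕ) : ℤ) w)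
      (cofreeTorsionLocalInclusion_cofreeTorsionLocalInclLE S ρ w hkK)]

/-- `tAway` along `(n, k) ≤ (n, k)` is the identity. [cite: SerreGaloisCohomology1997, I §2.4] -/
theorem tAway_refl {n k : ℕ} (y : Dlev S κ ρ w n k) : tAway S κ ρ w (le_refl n) (le_refl k) y = y := by
  rw [tAway_apply, resLe_refl_apply, AwayKernel.cohomologyMap_subgroupRepMap_congr (f' := 𝟙 _) (cofreeTorsionLocalInclLE_refl_apply S ρ w),
    AwayKernel.cohomologyMap_subgroupRepMap_id_apply]

/-- `tAway` along `(n, k) ≤ (m, k)` is the restriction `res_{U_m ≤ U_n}`. [cite: SerreGaloisCohomology1997, I §2.5] -/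
theorem tAway_left {n m k : ℕ} (hnm : n ≤ m) (y : Dlev S κ ρ w n k) :
    tAway S κ ρ w hnm (le_refl k) y =
      resLe (localRepOf (cofreeTorsionGaloisModule S ρ ((2 ^ k : ℕ) : ℤ)) w) (ProfiniteExhaustion.antitone_layerGroup κ w hnm) 1 y := by
  rw [tAway_apply, AwayKernel.cohomologyMap_subgroupRepMap_congr (f' := 𝟙 _) (cofreeTorsionLocalInclLE_refl_apply S ρ w),
    AwayKernel.cohomologyMap_subgroupRepMap_id_apply]

/-- **The one-step transition in `k` is the push-forward along tp2-p2x's `cofreeTorsionLocalIncl`** (the currency of the `k`-direction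
value compatibility `…DeepHalfAwayTwoTowerPow`). [cite: Kato2004Asterisque, §13.8 (p. 228)] -/
theorem tAway_succ_right {n k : ℕ} (y : Dlev S κ ρ w n k) :
    tAway S κ ρ w (le_refl n) (Nat.le_succ k) y =
      cohomologyMap (subgroupRepMap (Y := localRepOf (cofreeTorsionGaloisModule S ρ ((2 ^ (k + 1) : ℕ) : ℤ)) w)
        (cofreeTorsionLocalIncl S ρ k w) (layerGroup κ w n)) 1 y := by
  rw [tAway_apply, resLe_refl_apply, AwayKernel.cohomologyMap_subgroupRepMap_congr (cofreeTorsionLocalInclLE_succ_apply S ρ w)]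

/-- **Functoriality** `t_{(m,K) ≤ (m',K')} ∘ t_{(n,k) ≤ (m,K)} = t_{(n,k) ≤ (m',K')}`. [cite: SerreGaloisCohomology1997, I §2.4] -/
theorem tAway_tAway {n m m' k K K' : ℕ} (hnm : n ≤ m) (hmm' : m ≤ m') (hkK : k ≤ K) (hKK' : K ≤ K') (y : Dlev S κ ρ w n k) :
    tAway S κ ρ w hmm' hKK' (tAway S κ ρ w hnm hkK y) = tAway S κ ρ w (hnm.trans hmm') (hkK.trans hKK') y := by
  rw [tAway_apply, tAway_apply, tAway_apply,
    AwayKernel.cohomologyMap_resLe_cohomologyMap_resLe_of_forall_apply _ _ (cofreeTorsionLocalInclLE S ρ w (hkK.trans hKK'))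
      (cofreeTorsionLocalInclLE_cofreeTorsionLocalInclLE_apply S ρ w hkK hKK')]

/-- `res_{U_{m'} ≤ U_m} ∘ t_{(n,k) ≤ (m,K)} = t_{(n,k) ≤ (m',K)}`. [cite: SerreGaloisCohomology1997, I §2.5] -/
theorem resLe_tAway {n m m' k K : ℕ} (hnm : n ≤ m) (hmm' : m ≤ m') (hkK : k ≤ K) (y : Dlev S κ ρ w n k) :
    resLe (localRepOf (cofreeTorsionGaloisModule S ρ ((2 ^ K : ℕ) : ℤ)) w) (ProfiniteExhaustion.antitone_layerGroup κ w hmm') 1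
        (tAway S κ ρ w hnm hkK y) = tAway S κ ρ w (hnm.trans hmm') hkK y := by
  rw [tAway_apply, tAway_apply, AwayKernel.resLe_cohomologyMap_subgroupRepMap, resLe_resLe_apply]

/-- `j ∘ t = j` along `n` alone: `jAway w m k (res y) = jAway w n k y` for `n ≤ m` (`jAway_resLe` in `tAway` currency).
[cite: SerreGaloisCohomology1997, I §2.5] -/
theorem jAway_tAway_left {n m k : ℕ} (hnm : n ≤ m) (y : Dlev S κ ρ w n k) :
    jAway S κ ρ w m k (tAway S κ ρ w hnm (le_refl k) y) = jAway S κ ρ w n k y :=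
  jAway_tAway S κ ρ w hnm (le_refl k) y

/-! ## §3 The kernel criterion for `jAway` -/

/-- **KERNEL CRITERION for `jAway`** (injectivity half of `D_w = lim→_{n,k} H¹(U_{n,w}, A_ρ[2^k])`): a level class `y ∈ H¹(U_{n,w}, A_ρ[2^k])`
dying in `D_w` dies at a deeper level — `tAway y = 0` in `H¹(U_{m,w}, A_ρ[2^K])` for some `m ≥ n`, `K ≥ k`. Coefficient direction: the
coboundary witness `v ∈ A_ρ` of `ψ|_{U_∞}` is `2`-primary (`ProfiniteExhaustion.exists_pow_smul_cofree_eq_zero`), so lies in some `A_ρ[2^K]`,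
`K ≥ k`, and `ψ|_{U_∞} = ∂v` already in `H¹(U_∞, A_ρ[2^K])`; group direction: `AwayKernel.exists_resLe_layerGroup_eq_zero` on `U_{m,w} ↘ U_{∞,w}`.
[cite: SerreGaloisCohomology1997, I §2.2 Prop. 8] [cite: GreenbergVatsal2000, §2 Prop. 2.4] -/
theorem exists_tAway_eq_zero_of_jAway_eq_zero {n k : ℕ} (y : Dlev S κ ρ w n k) (hy : jAway S κ ρ w n k y = 0) :
    ∃ m, ∃ hm : n ≤ m, ∃ K, ∃ hK : k ≤ K, tAway S κ ρ w hm hK y = 0 := by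
  obtain ⟨ψ, rfl⟩ := oneCocycleClass_surjective _ y
  rw [jAway_apply] at hy
  obtain ⟨v, hv⟩ := AwayKernel.exists_of_cohomologyMap_resLe_oneCocycleClass_eq_zero _ _ ψ hy
  -- coefficient direction: `v ∈ A_ρ[2^K₀]`
  obtain ⟨K₀, hK₀⟩ := ProfiniteExhaustion.exists_pow_smul_cofree_eq_zero S ρ v
  have hvK : ∀ K, K₀ ≤ K → v ∈ AddSubgroup.torsionBy (Cofree ρ ↥(padicCoeffField S)) ((2 ^ K : ℕ) : ℤ) := fun K hK ↦ by
    rw [AddSubgroup.torsionBy, Submodule.mem_toAddSubgroup, Submodule.mem_torsionBy_iff]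
    obtain ⟨e, rfl⟩ := Nat.exists_eq_add_of_le hK
    change ((2 ^ (K₀ + e) : ℕ) : ℤ) • v = 0
    rw [natCast_zsmul, pow_add, mul_comm, mul_smul, hK₀, smul_zero]
  set K := max k K₀ with hKdef
  have hkK : k ≤ K := le_max_left k K₀
  -- `ψ|_{U_∞}` pushed to `A_ρ[2^K]` is the coboundary of `v`, seen as a point of `A_ρ[2^K]`
  have hinf : cohomologyMap (subgroupRepMap (Y := localRepOf (cofreeTorsionGaloisModule S ρ ((2 ^ K : ℕ) : ℤ)) w)
      (cofreeTorsionLocalInclLE S ρ w hkK) (kerGroup κ w)) 1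
      (resLe (localRepOf (cofreeTorsionGaloisModule S ρ ((2 ^ k : ℕ) : ℤ)) w) (kerGroup_le_layerGroup κ w n) 1 (oneCocycleClass _ ψ)) = 0 := by
    refine AwayKernel.cohomologyMap_resLe_oneCocycleClass_eq_zero_of_forall_apply _ (cofreeTorsionLocalInclusion S ρ ((2 ^ K : ℕ) : ℤ) w)
      (cofreeTorsionLocalInclusion_injective S ρ w _) _ ψ ⟨v, hvK K (le_max_right k K₀)⟩ fun g ↦ ?_
    rw [cofreeTorsionLocalInclusion_cofreeTorsionLocalInclLE, hv g, cofreeTorsionLocalInclusion_apply]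
  -- in `tAway` currency: `res_{U_∞ ≤ U_n} (t_{(n,k) ≤ (n,K)} [ψ]) = 0`
  have hinf' : resLe (localRepOf (cofreeTorsionGaloisModule S ρ ((2 ^ K : ℕ) : ℤ)) w) (kerGroup_le_layerGroup κ w n) 1
      (tAway S κ ρ w (le_refl n) hkK (oneCocycleClass _ ψ)) = 0 := by
    rw [tAway_apply, AwayKernel.resLe_cohomologyMap_subgroupRepMap, resLe_resLe_apply]
    exact hinf
  -- group direction
  obtain ⟨m, hm, hres⟩ := AwayKernel.exists_resLe_layerGroup_eq_zero κ w (cofreeTorsionGaloisModule S ρ ((2 ^ K : ℕ) : ℤ)) _ hinf'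
  refine ⟨m, hm, K, hkK, ?_⟩
  rw [← resLe_tAway S κ ρ w (le_refl n) hm hkK, hres]

end Summit.BirchSwinnertonDyer.BirchSwinnertonDyer.Theorems.OnePair

end
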